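import Summits.QuantumFields.YangMills.Theorems.AllWindowsColdBoxBoxHighWindowsSU22LineDefs
import Summits.QuantumFields.YangMills.Theorems.AllWindowsColdBoxBoxHighLineHodgeBootstrap

/-!
# LINE-20 «landau-rung3» on the HIGH item `AllWindowsColdBox.BoxWindowHighSU2213` (⟨stmt-QuantumFields-24336⟩; parent crux
# ⟨stmt-QuantumFields-24004⟩ `BoxHighWindowsSU22`): the NEW obligation Props of the line, VERBATIM from the registered skeleton of record
# (planner ym-idea-2 g17, skeleton v2, sha16 `087a0f4e9ce4ecb4`, tree `Cruxes/BoxWindowHighSU2213/Lines/landau_rung3.lean` commit 207e19e20fd8)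

The registered stubs of LINE-20 are U1 `stub_landauKernelPackage : LandauKernelPackage`, U2 `stub_landauRepresentativeStrong :
LandauRepresentativeBound`, U3 `stub_landauBallUniqueness : LandauBallUniqueness`, U5 `stub_landauThirdOrder : ∀ θL < 1/10, … →
LandauRelativeComparison θL`, U6 `stub_boxWindowHigh11 : BoxWindowHighSU22 (1/11)`.  U2 and U6 are stated over Props that already live in
the tree (`…AllWindowsColdBoxBoxHighWindowsSU22LineDefs`, ✓p716728); U1, U3 and the line's window aliases are stated over FIVE Props that the
skeleton DEFINES: `LandauDipoleDecay`, `LandauKernelPackage`, `LandauBallUniqueness`, `BoxWindowSU22`, `BoxWindowUpToSU22`.  This file copies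
those five VERBATIM (same names, same bodies) into the shared line namespace `…Theorems.AllWindowsColdBoxBoxHighLine` — the LINE-19 precedent
(`…BoxHighWindowsSU22LineDefs`) — so that the by-name files `theorem stub_… : <Prop>` of U1 / U3 agree literally with the registered signatures
and the skeleton can import this module and drop its local copies.  Definitions only; nothing is proved here.

HONEST LABEL: bookkeeping for ONE critic-stamped line (rung 3 of the Landau chart, windows `1/13 < θ ≤ 1/11`) on the R2ξ″ all-windows crux;
no stub, crux, rung or summit is proved; the Yang–Mills mass gap is NOT proved by this file.
-/

set_option autoImplicit false

noncomputable section

open MeasureTheory Matrix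
open Literature.MathematicalPhysics.QuantumFieldTheory
open Literature.MathematicalPhysics.QuantumFieldTheory.LatticeMaxwell
open Literature.MathematicalPhysics.QuantumFieldTheory.AxialGauge
open Summit.QuantumFields.YangMills.Theorems.WeakCouplingRates

namespace Summit.QuantumFields.YangMills.Theorems.AllWindowsColdBoxBoxHighLine

/-! ## New obligation Props of LINE-20 (verbatim from the skeleton, §«New obligation Props of the line») -/

/-- U1c: DIPOLE decay of the gauge-invariant circulation kernel `K(p,q) = λ_pᵀ hodgeQ⁻¹ λ_q` (= `boxDirProjKernel` by S2 ✓p717397), in the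
ℓ¹ convention of `LandauKernelGradDecay`: `|K(p,q)| ≤ C(1+log H)/(1+‖p−q‖₁)⁴`.  (LINE-18's dipole law is the torus/bulk analogue; here the cold
wall is Dirichlet, images do not spoil the exponent.) -/
def LandauDipoleDecay : Prop :=
  ∃ C : ℝ, ∀ H : ℕ, 1 ≤ H → ∀ p q : Plaq 4,
    |landauCoeff H p ⬝ᵥ ((hodgeQ H)⁻¹ *ᵥ landauCoeff H q)| ≤
      C * (1 + Real.log H) / (1 + (((∑ m : Fin 4, |p.1 m - q.1 m|) : ℤ) : ℝ)) ^ 4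

/-- U1 statement: the KERNEL PACKAGE of rung 3 = LINE-19's S3 (`LandauVarianceBounded ∧ LandauKernelDecay`) + the gradient decay H4b.1′
(`LandauKernelGradDecay`, typed in ✓p718104) + the dipole decay U1c.  These are exactly the pointwise bounds under which every one-loop class of
the Landau sector is a convergent/marginal lattice sum (`Σ (1+d)⁻³(1+d)⁻³ ≍ T⁻²`, `Σ (1+d)⁻⁴(1+d)⁻⁴ ≍ T⁻⁴ log`). -/
def LandauKernelPackage : Prop :=
  (LandauVarianceBounded ∧ LandauKernelDecay) ∧ LandauKernelGradDecay ∧ LandauDipoleDecay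

/-- U3 statement **(Gribov uniqueness in the small ball with the SHARP radius condition `r·H ≤ c₀`; M, deterministic)**: two interior gauge
transforms that both put `U` in lattice Landau gauge with all box links within defect `r²` of the identity coincide.  Proof route: `h = g'·g⁻¹`
is interior, `‖h_x − h_y‖ ≤ 2√2·r` across every box edge and `h = 1` on the boundary layer ⇒ `‖h_x − 1‖ ≤ 2√2·r·H`, so `h = exp λ` with
`|λ| ≲ rH`; along `t ↦ exp(tλ)` the Landau functional has second variation `−‖d₀λ‖² + Re tr(E_e (d₀λ_e)²) + Re tr(E_e [λ_x, d₀λ_e])` with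
`‖E_e‖ ≲ r`, and `Σ_e r|λ_x||d₀λ_e| ≤ r·‖λ‖‖d₀λ‖ ≤ C·r·H·‖d₀λ‖²` (Poincaré for site fields vanishing on the boundary) — strictly concave for
`rH ≤ c₀`, so its derivative cannot vanish at both `t = 0` and `t = 1` unless `λ = 0`.  LINE-19 used the conservative `r·H³ → 0`. -/
def LandauBallUniqueness : Prop :=
  ∃ c₀ : ℝ, 0 < c₀ ∧ ∀ H : ℕ, 1 ≤ H → ∀ r : ℝ, 0 ≤ r → r * (H : ℝ) ≤ c₀ →
    ∀ U : Literature.MathematicalPhysics.QuantumLattice.LGConfig 4 SU2,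
    ∀ g g' : Literature.Probability.LatticeModels.Site 4 → SU2, IsInteriorGauge H g → IsInteriorGauge H g' →
      (∀ e ∈ boxEdges 4 (2 * H + 1), linkDefect (Literature.MathematicalPhysics.QuantumLattice.gaugeTransformZd g U) e ≤ r ^ 2) →
      (∀ e ∈ boxEdges 4 (2 * H + 1), linkDefect (Literature.MathematicalPhysics.QuantumLattice.gaugeTransformZd g' U) e ≤ r ^ 2) →
      InLandauGauge H (Literature.MathematicalPhysics.QuantumLattice.gaugeTransformZd g U) →
      InLandauGauge H (Literature.MathematicalPhysics.QuantumLattice.gaugeTransformZd g' U) → g = g'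

/-- The windows `lo < θ ≤ hi` of the crux (local; the MID target of the line is `BoxWindowSU22 (1/13) (1/11)`; a route item with this body,
if director-ym adds one as for ⟨24335⟩/⟨24336⟩, is definitionally equal). -/
def BoxWindowSU22 (lo hi : ℝ) : Prop :=
  ∀ A θ : ℝ, 0 < A → A < θ → θ ≤ 7 * A → lo < θ → θ ≤ hi →
    ∃ c : ℝ, 0 < c ∧ BoxTwoPointDomination (G := SU2) (Literature.MathematicalPhysics.QuantumLattice.fundamentalRep (Fin 2)) A θ c

/-- Every window up to `θL` (no lower cut): what the Landau stubs deliver through the relative currency. -/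
def BoxWindowUpToSU22 (θL : ℝ) : Prop :=
  ∀ A θ : ℝ, 0 < A → A < θ → θ ≤ θL →
    ∃ c : ℝ, 0 < c ∧ BoxTwoPointDomination (G := SU2) (Literature.MathematicalPhysics.QuantumLattice.fundamentalRep (Fin 2)) A θ c

end Summit.QuantumFields.YangMills.Theorems.AllWindowsColdBoxBoxHighLine

end
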